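import Mathlib
import HarnessLib
import Summits.HubbardSuperconductivity.HubbardSuperconductivity.Theorems.FunctionFieldCertificateWindowInfraredBoundEngines
import Summits.HubbardSuperconductivity.HubbardSuperconductivity.Theorems.WeakCouplingBCSWcbcsSsbToTorusLROTwoParticleCost

/-!
# Crux `WindowInfraredBound` (stmt-HubbardSuperconductivity-1089) — Engine B with the two-particle
# cost discharged

`Theorems/FunctionFieldCertificateWindowInfraredBoundEngines.lean` reduces the crux to three hypotheses
(`wib_of_torusPairStiffness`): (T) the torus pair stiffness in variational form, (Ch) the charging floor
`pairGap ≥ -κ/L`, and (F3) the two-particle cost `|E(N_L) - E(N_L - 2)| ≤ C₃`, flagged there as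
"provable now". (F3) IS proved in the tree, for every side `L ≥ 4` and every `(U, δ)`, by the sibling
crux's `WcbcsSsbToTorusLRO.tpc_torus_summit` (one-particle cost on a graph of degree `≤ 4`, twice). This
file discharges it: `WindowInfraredBound` follows from (T) and (Ch) alone
(`wib_of_stiffness_of_charging`). Both remaining inputs are ground-state ENERGY statements, pointwise in
`(U, δ)`; neither has a finite decidable instance. No definition, no named fact, no sorry.

Sources: L. Pitaevskii, S. Stringari, J. Low Temp. Phys. 85 (1991) 377 (moment method);
T. Kennedy, E. H. Lieb, B. S. Shastry, PRL 61 (1988) 2582 (shape of the infrared bound).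
-/

namespace Summit.HubbardSuperconductivity.HubbardSuperconductivity.Theorems

-- summit = problem name (single-conjunct summit, D-0017): `HubbardSuperconductivity` occurs twice in the path
set_option linter.dupNamespace false

open Literature.MathematicalPhysics.QuantumLattice Literature.Probability.LatticeModels Matrix Finset
open scoped ComplexOrder ComplexConjugate
open Summit.HubbardSuperconductivity.HubbardSuperconductivity.Theses

/-- **(F3) holds**: the two-particle cost at the summit filling, in the shape of hypothesis `hF3` of
`wib_of_torusPairStiffness` — for all `U > 0`, `δ ∈ (0, 1/2)` there is `C₃ ≥ 0` with
`|E(N_L) - E(N_L - 2)| ≤ C₃` for every (even) `L ≥ 4`, `E(M) = minEnergyOn (hubbardTorus 2 L 1 U) (szSector M 0)`,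
`N_L = 2⌊(1-δ)L²/2⌋`. Immediate from `WcbcsSsbToTorusLRO.tpc_torus_summit` (`C₃ = 16 · 9 · 2(2 + |U|)`).
[folklore] -/
theorem wib_twoParticleCost :
    ∀ U : ℝ, 0 < U → ∀ δ ∈ Set.Ioo (0:ℝ) (1 / 2), ∃ C₃ : ℝ, 0 ≤ C₃ ∧ ∃ L₀ : ℕ,
      ∀ (L : ℕ) [NeZero L], L₀ ≤ L → Even L →
        |(hubbardTorus 2 L 1 U).minEnergyOn (szSector (2 * ⌊(1 - δ) * (L : ℝ) ^ 2 / 2⌋₊) 0) -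
          (hubbardTorus 2 L 1 U).minEnergyOn (szSector (2 * ⌊(1 - δ) * (L : ℝ) ^ 2 / 2⌋₊ - 2) 0)| ≤
          C₃ := by
  intro U _ δ hδ
  refine ⟨16 * (((2 * 4 + 1 : ℕ) : ℝ) * (2 * (2 * |(1 : ℝ)| + |U|))), by positivity, 4,
    fun L _ hL _ => ?_⟩
  exact (WcbcsSsbToTorusLRO.tpc_torus_summit U δ hδ L hL).1

/-- **Engine B ⇒ the crux, with (F3) discharged.** `WindowInfraredBound` follows from the two
ground-state energy inputs of `wib_of_torusPairStiffness` alone: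
(T) the TORUS PAIR STIFFNESS in variational form at every window momentum `0 < |q_m| ≤ η` — for every
normalised `(N_L, 0)`-sector ground state `ψ`, `2Re⟨w, Δ_d(m)ψ⟩ - Re⟨w, (H - E(N_L-2)) w⟩ ≤ C_X L²/|q_m|²`
on `(N_L - 2, 0)` and the twin with `Δ_d(m)ᴴψ`, `E(N_L+2)` on `(N_L + 2, 0)` (optimised over `w` this is the
static pair susceptibility bound `⟨Δψ, (H - E₋)⁻¹ Δψ⟩ ≤ C_X L²/|q|²`, the Gaussian-domination shape), and
(Ch) the CHARGING FLOOR `pairGap (hubbardTorus 2 L 1 U) N_L ≥ -κ/L` along even sides.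
The two-particle cost (F3) is `wib_twoParticleCost`; (F1), (F2) were already landed. [folklore] -/
theorem wib_of_stiffness_of_charging
    (hT : ∀ U : ℝ, 0 < U → ∀ δ ∈ Set.Ioo (0:ℝ) (1 / 2), ∃ C_X η : ℝ, 0 ≤ C_X ∧ 0 < η ∧ ∃ L₀ : ℕ,
      ∀ (L : ℕ) [NeZero L], L₀ ≤ L → Even L → ∀ ψ : Fock (Orb (FermionTorus 2 L)),
        star ψ ⬝ᵥ ψ = 1 →
          IsGroundStateInSector (hubbardTorus 2 L 1 U) (2 * ⌊(1 - δ) * (L : ℝ) ^ 2 / 2⌋₊) 0 ψ →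
            ∀ m : TorusSite 2 L, m ≠ 0 → momentumNormSq L m ≤ η ^ 2 →
              (∀ w : Fock (Orb (FermionTorus 2 L)),
                w ∈ szSector (Λ := FermionTorus 2 L) (2 * ⌊(1 - δ) * (L : ℝ) ^ 2 / 2⌋₊ - 2) 0 →
                  2 * (star w ⬝ᵥ (pairFieldAt dWaveFormFactor L m *ᵥ ψ)).re -
                    ((star w ⬝ᵥ (hubbardTorus 2 L 1 U *ᵥ w)).re -
                      (hubbardTorus 2 L 1 U).minEnergyOn
                        (szSector (2 * ⌊(1 - δ) * (L : ℝ) ^ 2 / 2⌋₊ - 2) 0) * (star w ⬝ᵥ w).re) ≤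
                    C_X * (L : ℝ) ^ 2 / momentumNormSq L m) ∧
              (∀ w : Fock (Orb (FermionTorus 2 L)),
                w ∈ szSector (Λ := FermionTorus 2 L) (2 * ⌊(1 - δ) * (L : ℝ) ^ 2 / 2⌋₊ + 2) 0 →
                  2 * (star w ⬝ᵥ ((pairFieldAt dWaveFormFactor L m)ᴴ *ᵥ ψ)).re -
                    ((star w ⬝ᵥ (hubbardTorus 2 L 1 U *ᵥ w)).re -
                      (hubbardTorus 2 L 1 U).minEnergyOn
                        (szSector (2 * ⌊(1 - δ) * (L : ℝ) ^ 2 / 2⌋₊ + 2) 0) * (star w ⬝ᵥ w).re) ≤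
                    C_X * (L : ℝ) ^ 2 / momentumNormSq L m))
    (hCh : ∀ U : ℝ, 0 < U → ∀ δ ∈ Set.Ioo (0:ℝ) (1 / 2), ∃ κ : ℝ, 0 ≤ κ ∧ ∃ L₀ : ℕ,
      ∀ (L : ℕ) [NeZero L], L₀ ≤ L → Even L →
        -(κ / (L : ℝ)) ≤ pairGap (hubbardTorus 2 L 1 U) (2 * ⌊(1 - δ) * (L : ℝ) ^ 2 / 2⌋₊)) :
    FunctionFieldCertificate.WindowInfraredBound :=
  wib_of_torusPairStiffness hT hCh wib_twoParticleCost

end Summit.HubbardSuperconductivity.HubbardSuperconductivity.Theorems
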